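import Mathlib.LinearAlgebra.Matrix.MvPolynomial
import Mathlib.RingTheory.MvPolynomial.Homogeneous
import Mathlib.RingTheory.Ideal.Maps
import Mathlib.Algebra.BigOperators.Pi
import Literature.LinearAlgebra.Matrix.RankMinors
import HarnessLib

/-!
# Determinantal ideals of the generic matrix

For index types `m`, `n`, a commutative ring `R` and `r : ℕ`, the *determinantal ideal*
`determinantalIdeal m n R r = I_r(X)` is the ideal of the polynomial ring
`R[X] = MvPolynomial (m × n) R` generated by all `r × r` minors of the *generic* `m × n` matrix
`X = Matrix.mvPolynomialX m n R`, whose `(i, j)` entry is the variable `X (i, j)`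
(Bruns–Vetter 1988, Ch. 1; Goodman–Wallach 2009, §12.2.4, "determinantal ideal";
De Concini–Eisenbud–Procesi 1980; Hochster–Eagon 1971).

## Main definitions

* `genericMinor R ρ γ`: the minor `det (X.submatrix ρ γ)` of the generic matrix with row map
  `ρ : Fin r → m` and column map `γ : Fin r → n`.
* `determinantalIdeal m n R r`: the ideal spanned by all `genericMinor R ρ γ`,
  `(ρ, γ) : (Fin r → m) × (Fin r → n)`.
* `rowColWeight m n`: the `ℕ^m × ℕ^n` (row/column) weight `X (i, j) ↦ (eᵢ, eⱼ)`.

## Main statements (all proved)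

* `determinantalIdeal_succ_le`, `determinantalIdeal_antitone`: `I_{r+1}(X) ≤ I_r(X)` (Laplace
  expansion along a row), hence `r ↦ I_r(X)` is antitone; `determinantalIdeal_zero : I_0 = ⊤`,
  `determinantalIdeal_eq_bot_of_card_lt_left/right : I_r = ⊥` for `r > #m` or `r > #n`.
* `isWeightedHomogeneous_genericMinor`, `determinantalIdeal_isHomogeneous_rowColWeight`:
  every minor is multihomogeneous for the row/column grading, so `I_r(X)` is a homogeneous
  ideal for it (and for the standard grading, `determinantalIdeal_isHomogeneous`).
* `det_mul_eq_zero_of_card_lt`: `det (A * B) = 0` for `A : ι × κ`, `B : κ × ι` over a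
  commutative ring with `#κ < #ι`; hence every element of `I_r(X)` vanishes at every product
  `A * B` through an inner dimension `< r` (`eval_eq_zero_of_mem_determinantalIdeal_of_card_lt`)
  and, over a field, at every matrix of rank `< r`
  (`eval_eq_zero_of_mem_determinantalIdeal_of_rank_lt`); indeed over a field the common zeros
  of `I_{t+1}(X)` are exactly the matrices of rank `≤ t` (`forall_eval_eq_zero_iff_rank_le`,
  via `Literature.LinearAlgebra.Matrix.rank_le_iff_det_submatrix_eq_zero`).

The Second Fundamental Theorem (the converse: over `ℂ` the polynomials vanishing on all
matrices of rank `≤ t` are exactly `I_{t+1}(X)`, Goodman–Wallach Thm. 12.2.12) is vendored as a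
named fact in `Literature/Computability/AlgebraicComplexity/DeterminantalIdealSFT.lean`.

## Design notes

* Generators are indexed by pairs of *maps* `(Fin r → m) × (Fin r → n)` rather than by pairs of
  `r`-subsets: a non-injective map gives the zero minor
  (`genericMinor_eq_zero_of_not_injective_left/right`) and reordering rows/columns changes a
  minor by a sign, so the ideal is the classical `I_r(X)`. This is literally the span written
  inline in route item `KernelIsMinors` of route ValiantsHypothesis/HartogsRankTwo
  (`determinantalIdeal (Fin n) (Fin n) ℂ 3` unfolds to it by `rfl`).
* No finiteness or decidability hypotheses on `m`, `n` are needed for the definition; they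
  appear only in the lemmas that need them (`Fintype` for ranks/cardinalities, `DecidableEq`
  for the `Finsupp`-valued grading).
* Mathlib (searched: `determinantal`, `minors`, `Ideal.span.*submatrix.*det`) has the generic
  matrix `Matrix.mvPolynomialX` and `Matrix.det_mvPolynomialX_ne_zero` but no determinantal
  ideals; nothing here duplicates Mathlib.
-/

noncomputable section

open MvPolynomial Matrix

namespace Literature.Computability.AlgebraicComplexity

universe u v w

variable {m : Type u} {n : Type v} (R : Type w) [CommRing R]

section Defs

/-- The generic `r × r` minor with row map `ρ` and column map `γ`: the determinant of the
submatrix of the generic matrix `X = Matrix.mvPolynomialX m n R` picking rows `ρ 0, …, ρ (r-1)`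
and columns `γ 0, …, γ (r-1)` (written `[ρ | γ]` in Bruns–Vetter 1988, Ch. 1). It is `0`
when `ρ` or `γ` is not injective. [cite: BrunsVetter1988, Ch. 1] -/
def genericMinor {r : ℕ} (ρ : Fin r → m) (γ : Fin r → n) : MvPolynomial (m × n) R :=
  ((Matrix.mvPolynomialX m n R).submatrix ρ γ).det

variable (m n)

/-- The **determinantal ideal** `I_r(X)` of the generic `m × n` matrix `X = (X (i, j))`: the
ideal of `MvPolynomial (m × n) R` generated by all `r × r` minors of `X`
(Goodman–Wallach 2009, §12.2.4; Bruns–Vetter 1988, Ch. 1). Generators are indexed by pairs of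
maps `(Fin r → m) × (Fin r → n)`; non-injective maps contribute the zero minor.
[cite: GoodmanWallachGTM255, §12.2.4] -/
def determinantalIdeal (r : ℕ) : Ideal (MvPolynomial (m × n) R) :=
  Ideal.span (Set.range fun rc : (Fin r → m) × (Fin r → n) =>
    ((Matrix.mvPolynomialX m n R).submatrix rc.1 rc.2).det)

/-- Unfolding lemma: `I_r(X)` is the span of the generic `r × r` minors. [folklore] -/
theorem determinantalIdeal_def (r : ℕ) :
    determinantalIdeal m n R r =
      Ideal.span (Set.range fun rc : (Fin r → m) × (Fin r → n) => genericMinor R rc.1 rc.2) :=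
  rfl

variable {m n}

/-- Entries of the generic submatrix are variables. [folklore] -/
@[simp] theorem mvPolynomialX_submatrix_apply {r : ℕ} (ρ : Fin r → m) (γ : Fin r → n)
    (i j : Fin r) : (Matrix.mvPolynomialX m n R).submatrix ρ γ i j = X (ρ i, γ j) :=
  rfl

/-- Every generic `r × r` minor lies in `I_r(X)`. [folklore] -/
theorem genericMinor_mem {r : ℕ} (ρ : Fin r → m) (γ : Fin r → n) :
    genericMinor R ρ γ ∈ determinantalIdeal m n R r :=
  Ideal.subset_span ⟨(ρ, γ), rfl⟩

/-- `I_r(X) ≤ I` iff `I` contains every generic `r × r` minor. [folklore] -/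
theorem determinantalIdeal_le_iff {r : ℕ} {I : Ideal (MvPolynomial (m × n) R)} :
    determinantalIdeal m n R r ≤ I ↔
      ∀ (ρ : Fin r → m) (γ : Fin r → n), genericMinor R ρ γ ∈ I := by
  rw [determinantalIdeal_def, Ideal.span_le, Set.range_subset_iff, Prod.forall]
  rfl

/-- A generic minor with a repeated row is zero. [folklore] -/
theorem genericMinor_eq_zero_of_not_injective_left {r : ℕ} {ρ : Fin r → m} (γ : Fin r → n)
    (h : ¬ Function.Injective ρ) : genericMinor R ρ γ = 0 := by
  simp only [Function.Injective, not_forall] at h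
  obtain ⟨i, j, hij, hne⟩ := h
  exact Matrix.det_zero_of_row_eq hne (funext fun k => by simp [hij])

/-- A generic minor with a repeated column is zero. [folklore] -/
theorem genericMinor_eq_zero_of_not_injective_right {r : ℕ} (ρ : Fin r → m) {γ : Fin r → n}
    (h : ¬ Function.Injective γ) : genericMinor R ρ γ = 0 := by
  simp only [Function.Injective, not_forall] at h
  obtain ⟨i, j, hij, hne⟩ := h
  exact Matrix.det_zero_of_column_eq hne fun k => by simp [hij]

/-- `I_r(X) = 0` as soon as `r` exceeds the number of rows. [folklore] -/
theorem determinantalIdeal_eq_bot_of_card_lt_left [Fintype m] {r : ℕ} (h : Fintype.card m < r) :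
    determinantalIdeal m n R r = ⊥ := by
  rw [eq_bot_iff, determinantalIdeal_le_iff]
  intro ρ γ
  rw [Ideal.mem_bot]
  refine genericMinor_eq_zero_of_not_injective_left R γ fun hρ => ?_
  have := Fintype.card_le_of_injective ρ hρ
  rw [Fintype.card_fin] at this
  omega

/-- `I_r(X) = 0` as soon as `r` exceeds the number of columns. [folklore] -/
theorem determinantalIdeal_eq_bot_of_card_lt_right [Fintype n] {r : ℕ} (h : Fintype.card n < r) :
    determinantalIdeal m n R r = ⊥ := by
  rw [eq_bot_iff, determinantalIdeal_le_iff]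
  intro ρ γ
  rw [Ideal.mem_bot]
  refine genericMinor_eq_zero_of_not_injective_right R ρ fun hγ => ?_
  have := Fintype.card_le_of_injective γ hγ
  rw [Fintype.card_fin] at this
  omega

/-- `I_0(X)` is the unit ideal (the empty minor is `1`). [folklore] -/
theorem determinantalIdeal_zero : determinantalIdeal m n R 0 = ⊤ := by
  rw [Ideal.eq_top_iff_one]
  have h := genericMinor_mem R (m := m) (n := n) (fun i : Fin 0 => i.elim0)
    (fun i : Fin 0 => i.elim0)
  simpa [genericMinor] using h

end Defs

section Laplace

/-- Laplace expansion along the first row writes an `(r+1) × (r+1)` generic minor as a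
combination of `r × r` generic minors, so it lies in `I_r(X)`
(Goodman–Wallach 2009, end of proof of Thm. 12.2.12). [cite: GoodmanWallachGTM255, Thm 12.2.12] -/
theorem genericMinor_succ_mem {r : ℕ} (ρ : Fin (r + 1) → m) (γ : Fin (r + 1) → n) :
    genericMinor R ρ γ ∈ determinantalIdeal m n R r := by
  unfold genericMinor
  rw [Matrix.det_succ_row_zero]
  refine Ideal.sum_mem _ fun j _ => Ideal.mul_mem_left _ _ ?_
  exact genericMinor_mem R (ρ ∘ Fin.succ) (γ ∘ j.succAbove)

/-- **Monotonicity**: `I_{r+1}(X) ≤ I_r(X)` (cofactor expansion;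
Goodman–Wallach 2009, proof of Thm. 12.2.12). [cite: GoodmanWallachGTM255, Thm 12.2.12] -/
theorem determinantalIdeal_succ_le (r : ℕ) :
    determinantalIdeal m n R (r + 1) ≤ determinantalIdeal m n R r :=
  (determinantalIdeal_le_iff R).mpr fun ρ γ => genericMinor_succ_mem R ρ γ

/-- The determinantal ideals decrease with the size of the minors: `r ≤ s → I_s(X) ≤ I_r(X)`.
[cite: GoodmanWallachGTM255, Thm 12.2.12] -/
theorem determinantalIdeal_antitone : Antitone (determinantalIdeal m n R) :=
  antitone_nat_of_succ_le (determinantalIdeal_succ_le R)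

end Laplace

section Homogeneous

/-- A determinant whose `(i, j)` entry is weighted-homogeneous of weight `a i + b j` is
weighted-homogeneous of weight `∑ a + ∑ b` (expand over permutations). A special case of
`Literature.RingTheory.MvPolynomial.det_isWeightedHomogeneous` (OstrowskiResultant.lean), re-proved
here in eight lines to keep this file's imports inside Mathlib + `RankMinors`. [folklore] -/
theorem isWeightedHomogeneous_det {ι σ M : Type*} [Fintype ι] [DecidableEq ι] [AddCommMonoid M]
    (w : σ → M) (A : Matrix ι ι (MvPolynomial σ R)) (a b : ι → M)
    (hA : ∀ i j, IsWeightedHomogeneous w (A i j) (a i + b j)) :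
    IsWeightedHomogeneous w A.det (∑ i, a i + ∑ i, b i) := by
  rw [Matrix.det_apply']
  refine IsWeightedHomogeneous.sum _ _ _ fun π _ => ?_
  have h := IsWeightedHomogeneous.prod Finset.univ (fun i => A (π i) i) (fun i => a (π i) + b i)
    fun i _ => hA (π i) i
  rw [Finset.sum_add_distrib, Equiv.sum_comp π a] at h
  rw [← map_intCast (MvPolynomial.C : R →+* MvPolynomial σ R)]
  exact h.C_mul _

variable (m n)

/-- The row/column (`ℕ^m × ℕ^n`) weight on the variables of the generic matrix:
`X (i, j) ↦ (eᵢ, eⱼ)`. Torus weights for the two-sided `GL_m × GL_n` action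
(Goodman–Wallach 2009, §12.2.4). [cite: GoodmanWallachGTM255, §12.2.4] -/
def rowColWeight : m × n → (m →₀ ℕ) × (n →₀ ℕ) :=
  fun ij => (Finsupp.single ij.1 1, Finsupp.single ij.2 1)

variable {m n}

/-- `rowColWeight` on a variable. [folklore] -/
@[simp] theorem rowColWeight_apply (i : m) (j : n) :
    rowColWeight m n (i, j) = (Finsupp.single i 1, Finsupp.single j 1) :=
  rfl

/-- **Multihomogeneity**: the generic minor `[ρ | γ]` is homogeneous of weight
`(∑ e_{ρ i}, ∑ e_{γ i})` for the row/column grading. [folklore] -/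
theorem isWeightedHomogeneous_genericMinor {r : ℕ} (ρ : Fin r → m) (γ : Fin r → n) :
    IsWeightedHomogeneous (rowColWeight m n) (genericMinor R ρ γ)
      (∑ i, Finsupp.single (ρ i) 1, ∑ i, Finsupp.single (γ i) 1) := by
  have h := isWeightedHomogeneous_det R (rowColWeight m n)
    ((Matrix.mvPolynomialX m n R).submatrix ρ γ)
    (fun i => (Finsupp.single (ρ i) 1, 0)) (fun j => (0, Finsupp.single (γ j) 1))
    (fun i j => by
      simpa using isWeightedHomogeneous_X R (rowColWeight m n) (ρ i, γ j))
  have hsum : ((∑ i, ((Finsupp.single (ρ i) 1, 0) : (m →₀ ℕ) × (n →₀ ℕ))) +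
      ∑ j, (((0 : m →₀ ℕ), Finsupp.single (γ j) 1) : (m →₀ ℕ) × (n →₀ ℕ))) =
      (∑ i, Finsupp.single (ρ i) 1, ∑ i, Finsupp.single (γ i) 1) :=
    Prod.ext (by simp [Prod.fst_sum]) (by simp [Prod.snd_sum])
  rw [hsum] at h
  exact h

/-- The generic `r × r` minor is homogeneous of degree `r` for the standard grading. [folklore] -/
theorem isHomogeneous_genericMinor {r : ℕ} (ρ : Fin r → m) (γ : Fin r → n) :
    (genericMinor R ρ γ).IsHomogeneous r := by
  have h := isWeightedHomogeneous_det R (1 : m × n → ℕ)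
    ((Matrix.mvPolynomialX m n R).submatrix ρ γ) (fun _ => 1) (fun _ => 0)
    (fun i j => by simpa using isWeightedHomogeneous_X R (1 : m × n → ℕ) (ρ i, γ j))
  simpa [genericMinor, IsHomogeneous] using h

section Graded

-- Mathlib deliberately keeps these `GradedAlgebra` structures on `MvPolynomial` as non-instance
-- `def`s ("To make it a local instance, you may use `attribute [local instance] …`", docstring of
-- `MvPolynomial.gradedAlgebra`); they are needed locally only to *state* `Ideal.IsHomogeneous`.
attribute [local instance] MvPolynomial.weightedGradedAlgebra MvPolynomial.gradedAlgebra

/-- `I_r(X)` is a homogeneous ideal for the row/column (`ℕ^m × ℕ^n`) grading of `R[X]`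
(with Mathlib's `MvPolynomial.weightedGradedAlgebra` structure for `rowColWeight`). [folklore] -/
theorem determinantalIdeal_isHomogeneous_rowColWeight [DecidableEq m] [DecidableEq n] (r : ℕ) :
    (determinantalIdeal m n R r).IsHomogeneous
      (weightedHomogeneousSubmodule R (rowColWeight m n)) := by
  refine Ideal.homogeneous_span _ _ ?_
  rintro _ ⟨⟨ρ, γ⟩, rfl⟩
  exact ⟨_, isWeightedHomogeneous_genericMinor R ρ γ⟩

/-- `I_r(X)` is a homogeneous ideal for the standard grading of `R[X]`. [folklore] -/
theorem determinantalIdeal_isHomogeneous (r : ℕ) :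
    (determinantalIdeal m n R r).IsHomogeneous (homogeneousSubmodule (m × n) R) := by
  refine Ideal.homogeneous_span _ _ ?_
  rintro _ ⟨⟨ρ, γ⟩, rfl⟩
  exact ⟨r, isHomogeneous_genericMinor R ρ γ⟩

/-- Every row/column-multihomogeneous component of an element of `I_r(X)` lies in `I_r(X)`.
[folklore] -/
theorem weightedHomogeneousComponent_mem_determinantalIdeal [DecidableEq m] [DecidableEq n]
    {r : ℕ} {p : MvPolynomial (m × n) R} (hp : p ∈ determinantalIdeal m n R r)
    (d : (m →₀ ℕ) × (n →₀ ℕ)) :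
    weightedHomogeneousComponent (rowColWeight m n) d p ∈ determinantalIdeal m n R r :=
  weightedHomogeneousComponent_mem_of_mem R _
    (determinantalIdeal_isHomogeneous_rowColWeight R r) hp d

/-- Every homogeneous component of an element of `I_r(X)` lies in `I_r(X)`. [folklore] -/
theorem homogeneousComponent_mem_determinantalIdeal {r : ℕ} {p : MvPolynomial (m × n) R}
    (hp : p ∈ determinantalIdeal m n R r) (d : ℕ) :
    homogeneousComponent d p ∈ determinantalIdeal m n R r :=
  homogeneousComponent_mem_of_mem (determinantalIdeal_isHomogeneous R r) hp d

end Graded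

end Homogeneous

section Vanishing

/-- Evaluating the generic minor `[ρ | γ]` at a point `a` gives the corresponding minor of the
matrix `(a (i, j))`. [folklore] -/
theorem eval_genericMinor {r : ℕ} (ρ : Fin r → m) (γ : Fin r → n) (a : m × n → R) :
    MvPolynomial.eval a (genericMinor R ρ γ) =
      ((Matrix.of fun i j => a (i, j)).submatrix ρ γ).det := by
  rw [genericMinor, RingHom.map_det]
  congr 1
  ext i j
  simp

/-- Same as `eval_genericMinor` for an algebra evaluation `aeval`. [folklore] -/
theorem aeval_genericMinor {S : Type*} [CommRing S] [Algebra R S] {r : ℕ} (ρ : Fin r → m)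
    (γ : Fin r → n) (a : m × n → S) :
    MvPolynomial.aeval a (genericMinor R ρ γ) =
      ((Matrix.of fun i j => a (i, j)).submatrix ρ γ).det := by
  rw [genericMinor, AlgHom.map_det]
  congr 1
  ext i j
  simp

/-- Over a commutative ring, `det (A * B) = 0` whenever `A : ι × κ`, `B : κ × ι` and
`#κ < #ι`: the product factors through the square matrices `A * E` and `Eᵀ * B` for a partial
permutation matrix `E`, and `A * E` has a zero column. [folklore] -/
theorem det_mul_eq_zero_of_card_lt {ι κ S : Type*} [Fintype ι] [Fintype κ] [DecidableEq ι]
    [DecidableEq κ] [CommRing S] (h : Fintype.card κ < Fintype.card ι) (A : Matrix ι κ S)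
    (B : Matrix κ ι S) : (A * B).det = 0 := by
  obtain ⟨f⟩ : Nonempty (κ ↪ ι) := Function.Embedding.nonempty_of_card_le h.le
  obtain ⟨j₀, hj₀⟩ : ∃ j₀, j₀ ∉ Set.range f := by
    by_contra hall
    simp only [not_exists, not_not] at hall
    exact absurd (Fintype.card_le_of_surjective f fun j => hall j) (not_le.mpr h)
  set E : Matrix κ ι S := (1 : Matrix ι ι S).submatrix f id with hE
  have hEE : E * Eᵀ = 1 := by
    rw [hE, Matrix.transpose_submatrix, Matrix.transpose_one,
      ← Matrix.submatrix_mul _ _ _ _ _ Function.bijective_id, Matrix.mul_one,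
      Matrix.submatrix_one _ f.injective]
  have hfac : A * B = (A * E) * (Eᵀ * B) := by
    rw [Matrix.mul_assoc, ← Matrix.mul_assoc E, hEE, Matrix.one_mul]
  rw [hfac, Matrix.det_mul, Matrix.det_eq_zero_of_column_eq_zero j₀, zero_mul]
  intro i
  rw [Matrix.mul_apply]
  refine Finset.sum_eq_zero fun l _ => ?_
  have hl : f l ≠ j₀ := fun hl => hj₀ ⟨l, hl⟩
  simp [hE, hl]

/-- All `r × r` minors of a product `A * B` through an inner dimension `< r` vanish.
[folklore] -/
theorem det_submatrix_mul_eq_zero {ι κ o S : Type*} [Fintype κ] [DecidableEq κ] [CommRing S]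
    {r : ℕ} (h : Fintype.card κ < r) (A : Matrix ι κ S) (B : Matrix κ o S) (ρ : Fin r → ι)
    (γ : Fin r → o) : ((A * B).submatrix ρ γ).det = 0 := by
  rw [Matrix.submatrix_mul _ _ _ _ _ Function.bijective_id]
  exact det_mul_eq_zero_of_card_lt (by simpa using h) _ _

/-- **Vanishing on low rank (ring form)**: every element of `I_r(X)` vanishes at every matrix
of the form `A * B` with inner dimension `< r`; in particular at every `U * Vᵀ` with
`U : m × (r-1)`, `V : n × (r-1)`. This is the easy inclusion of the Second Fundamental Theorem
(Goodman–Wallach 2009, §12.2.4). [cite: GoodmanWallachGTM255, §12.2.4] -/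
theorem eval_eq_zero_of_mem_determinantalIdeal_of_card_lt {κ : Type*} [Fintype κ]
    [DecidableEq κ] {r : ℕ} (h : Fintype.card κ < r) (A : Matrix m κ R) (B : Matrix κ n R)
    {p : MvPolynomial (m × n) R} (hp : p ∈ determinantalIdeal m n R r) :
    MvPolynomial.eval (fun ij => (A * B) ij.1 ij.2) p = 0 := by
  rw [← RingHom.mem_ker]
  refine ((determinantalIdeal_le_iff R).mpr (fun ρ γ => ?_)) hp
  rw [RingHom.mem_ker, eval_genericMinor]
  exact det_submatrix_mul_eq_zero h A B ρ γ

/-- **Vanishing on low rank (field form)**: over a field, every element of `I_r(X)` vanishes at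
every matrix of rank `< r` (Goodman–Wallach 2009, §12.2.4, `Δ_p ∈ 𝔍` iff `p > n`); the
minors themselves vanish by `Literature.LinearAlgebra.Matrix.det_submatrix_eq_zero_of_rank_lt_card`.
[cite: GoodmanWallachGTM255, §12.2.4] -/
theorem eval_eq_zero_of_mem_determinantalIdeal_of_rank_lt {K : Type*} [Field K] [Fintype n]
    {r : ℕ} (A : Matrix m n K) (hA : A.rank < r) {p : MvPolynomial (m × n) K}
    (hp : p ∈ determinantalIdeal m n K r) :
    MvPolynomial.eval (fun ij => A ij.1 ij.2) p = 0 := by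
  rw [← RingHom.mem_ker]
  refine ((determinantalIdeal_le_iff K).mpr (fun ρ γ => ?_)) hp
  rw [RingHom.mem_ker, eval_genericMinor]
  exact Literature.LinearAlgebra.Matrix.det_submatrix_eq_zero_of_rank_lt_card A ρ γ
    (by simpa using hA)

/-- Over a field, the common zeros of `I_{t+1}(X)` are exactly the matrices of rank `≤ t`
(the determinantal variety `DV_{m,n,t}`; Goodman–Wallach 2009, §12.2.4 with Lemma 5.2.4 (1)),
by the rank-via-minors characterisation
`Literature.LinearAlgebra.Matrix.rank_le_iff_det_submatrix_eq_zero`.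
[cite: GoodmanWallachGTM255, §12.2.4] -/
theorem forall_eval_eq_zero_iff_rank_le {K : Type*} [Field K] [Fintype m] [Fintype n] {t : ℕ}
    (A : Matrix m n K) :
    (∀ p ∈ determinantalIdeal m n K (t + 1),
        MvPolynomial.eval (fun ij => A ij.1 ij.2) p = 0) ↔ A.rank ≤ t := by
  refine ⟨fun h => ?_, fun h p hp =>
    eval_eq_zero_of_mem_determinantalIdeal_of_rank_lt A (Nat.lt_succ_of_le h) hp⟩
  refine Literature.LinearAlgebra.Matrix.rank_le_of_det_submatrix_eq_zero A fun ρ γ => ?_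
  have := h _ (genericMinor_mem K ρ γ)
  rwa [eval_genericMinor] at this

end Vanishing

end Literature.Computability.AlgebraicComplexity
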